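import Mathlib.MeasureTheory.Group.Integral
import Mathlib.MeasureTheory.Integral.Bochner.ContinuousLinearMap
import Mathlib.MeasureTheory.Integral.DominatedConvergence
import Mathlib.Analysis.Normed.Group.FunctionSeries
import Mathlib.Analysis.SpecialFunctions.Pow.Real
import Literature.MathematicalPhysics.QuantumLattice.HeatKernelGroup
import Literature.MathematicalPhysics.QuantumLattice.HeatKernelGroupCircleProofs
import HarnessLib

/-!
# The heat kernel of the circle group is a heat kernel — proved

Sibling proof file of `HeatKernelGroup.lean` (topic `Literature/MathematicalPhysics/QuantumLattice`;
the siblings `HeatKernelGroupProofs.lean`, `HeatKernelGroupCircleProofs.lean`,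
`HeatKernelGroupMeasureProofs.lean`, `HeatKernelGroupGaugeProofs.lean` discharge the other facts
of that file).  It discharges the named fact

* `Literature.MathematicalPhysics.QuantumLattice.isGroupHeatKernel_circleHeatKernel`:
  for every Borel structure on `Circle`, the explicit kernel
  `circleHeatKernel t z = ∑_{n ∈ ℤ} e^{-n²t/2} Re (zⁿ)` satisfies every axiom of the hypothesis
  structure `IsGroupHeatKernel` (jointly continuous on `(0,∞) × U(1)`, non-negative, normalised,
  Chapman–Kolmogorov, central, symmetric, approximate identity, no jumps) with respect to the
  normalised Haar measure `haarProbability Circle = haarMeasure ⊤`,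

as `isGroupHeatKernel_circleHeatKernel_holds`, from Mathlib alone (Haar measure, Bochner
integral, `jacobiTheta₂` and its functional equation).  No result is assumed.

## Source

* E. M. Stein, *Topics in Harmonic Analysis Related to the Littlewood–Paley Theory*, Annals of
  Mathematics Studies **63**, Princeton UP (1970), Ch. II §1, Theorem 1 (pp. 38–43): the heat
  semigroup `T^t = e^{tΔ}` of a compact Lie group is a positivity-preserving (v), normalised
  (vi: `T^t 1 = 1`), self-adjoint (iv) contraction semigroup (ii), strongly continuous on `C(G)`
  (iii), given by convolution with a smooth kernel `K_t` (viii) defined through the eigenfunction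
  expansion `T^t φ = e^{-μ t} φ` on the Peter–Weyl blocks.  For `G = U(1)` the characters are
  `e^{ikθ}` with `-Δ e^{ikθ} = k² e^{ikθ}`, and with the probabilists' time `e^{tΔ/2}` of
  `HeatKernelGroup.lean` the kernel is `p_t(e^{iθ}) = ∑ₖ e^{-k²t/2} e^{ikθ} = circleHeatKernel t`.
  [cite: Stein1970, Ch. II §1 Thm 1]

## The argument (Fourier analysis on `U(1)`, all w.r.t. `haarProbability Circle`)

* `integral_coe_zpow_haarProbability_circle`: `∫ zⁿ dz = [n = 0]` (rotate by `e^{iπ/n}` and use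
  left invariance of `haarMeasure ⊤`); hence absolutely convergent Fourier series may be
  integrated term by term (`integral_tsum_mul_coe_zpow_haarProbability_circle`).
* `ofReal_circleHeatKernel`: `p_t(z) = ∑ₙ e^{-n²t/2} zⁿ` as a complex series (the coefficients
  are even), so `∫ z^k p_t = e^{-k²t/2}` (`integral_coe_zpow_mul_circleHeatKernel`), in
  particular `∫ p_t = 1`, and `∫ hⁿ p_t(h⁻¹g) dh = e^{-n²t/2} gⁿ`, which gives Chapman–Kolmogorov
  `p_{s+t}(g) = ∫ p_s(h) p_t(h⁻¹g) dh` after a dominated interchange of sum and integral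
  (`circleHeatKernel_semigroup`).
* Positivity (`circleHeatKernel_nonneg`): `p_t(e^{iθ}) = ϑ(θ/2π, it/2π)`
  (`circleHeatKernel_eq_jacobiTheta₂_holds`, sibling file) and Jacobi's imaginary transformation
  `ϑ(z, τ) = (-iτ)^{-1/2} e^{-πiz²/τ} ϑ(z/τ, -1/τ)` (Mathlib's `jacobiTheta₂_functional_equation`,
  i.e. Poisson summation) turn `p_t(e^{iθ})` into the manifestly non-negative Villain form
  `√(2π/t) ∑ₘ e^{-(θ - 2πm)²/2t}`.
* Small time: with the test function `(1 - Re z)² = 3/2 - 2 Re z + Re(z²)/2` one gets the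
  fourth-moment identity `∫ (1 - Re z)² p_t = 3/2 - 2e^{-t/2} + e^{-2t}/2 ≤ (3/4) t²`
  (`integral_one_sub_re_sq_mul_circleHeatKernel`, `circleHeatKernel_moment_bound`); since
  `|z - 1|² = 2 (1 - Re z)` on the circle, a Chebyshev bound gives `∫_{Uᶜ} p_t = O(t²)`
  (`circleHeatKernel_noJumps`) and `|∫ f p_t - f(1)| ≤ ε/2 + K_ε · O(t²)`
  (`circleHeatKernel_tendsto_dirac`).
* Joint continuity on `[ε, ∞) × U(1)` by uniform convergence (`continuousOn_tsum` with the
  bound `e^{-n²ε/2}`), hence on the open set `(0, ∞) × U(1)`.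
-/

open MeasureTheory Filter Topology Complex
open Literature.MathematicalPhysics.QuantumFieldTheory (haarProbability)

noncomputable section

namespace Literature.MathematicalPhysics.QuantumLattice

/-! ### Gaussian coefficients -/

/-- The Gaussian Fourier coefficients `e^{-n² t/2}`, `t > 0`, are summable over `ℤ`
(they are the moduli of the terms of `ϑ(0, it/2π)`). [folklore] -/
theorem circleHeatKernel_summable_coeff {t : ℝ} (ht : 0 < t) :
    Summable fun n : ℤ => Real.exp (-(n : ℝ) ^ 2 * t / 2) := by
  have him : (((t / (2 * Real.pi) : ℝ) : ℂ) * I).im = t / (2 * Real.pi) := by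
    rw [Complex.mul_I_im, Complex.ofReal_re]
  have hτ : 0 < (((t / (2 * Real.pi) : ℝ) : ℂ) * I).im := by rw [him]; positivity
  have h := ((summable_jacobiTheta₂_term_iff 0 _).mpr hτ).norm
  refine h.congr fun n => ?_
  rw [norm_jacobiTheta₂_term, him, Complex.zero_im, mul_zero, sub_zero]
  congr 1
  field_simp

/-! ### Fourier analysis on `Circle` with respect to `haarProbability Circle` -/

/-- Orthogonality of characters of `U(1)`: `∫ zⁿ dz = [n = 0]` for the normalised Haar
measure (rotate by `w = e^{iπ/n}`, `wⁿ = -1 ≠ 1`, and use left invariance). [folklore] -/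
theorem integral_coe_zpow_haarProbability_circle [MeasurableSpace Circle] [BorelSpace Circle] (n : ℤ) :
    ∫ z, (z : ℂ) ^ n ∂(haarProbability Circle) = if n = 0 then 1 else 0 := by
  haveI : (haarProbability Circle).IsMulLeftInvariant := by
    unfold haarProbability; infer_instance
  split_ifs with hn
  · simp [hn]
  · set w : Circle := Circle.exp (Real.pi / n) with hw
    have hwn : (w : ℂ) ^ n ≠ 1 := by
      rw [← Circle.coe_zpow, hw, ← Circle.exp_intCast_mul,
        mul_div_cancel₀ _ (Int.cast_ne_zero.mpr hn), Circle.coe_exp, Complex.exp_pi_mul_I]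
      norm_num
    have h := integral_mul_left_eq_self (μ := haarProbability Circle)
      (fun z : Circle => (z : ℂ) ^ n) w
    simp only [Circle.coe_mul, mul_zpow] at h
    rw [integral_const_mul] at h
    have h' : ((w : ℂ) ^ n - 1) * ∫ z, (z : ℂ) ^ n ∂(haarProbability Circle) = 0 := by
      rw [sub_mul, one_mul, h, sub_self]
    rcases mul_eq_zero.mp h' with h1 | h1
    · exact absurd (sub_eq_zero.mp h1) hwn
    · exact h1

/-- `z ↦ zᵐ` is continuous `Circle → ℂ`. [folklore] -/
theorem continuous_circle_coe_zpow (m : ℤ) : Continuous fun z : Circle => (z : ℂ) ^ m :=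
  have hcoe : Continuous fun z : Circle => (z : ℂ) := continuous_subtype_val
  hcoe.zpow₀ m fun z => Or.inl (Circle.coe_ne_zero z)

/-- Term-wise integration of an absolutely convergent Fourier series against Haar measure:
`∫ ∑ₘ cₘ z^{e(m)} dz = c_k` when `e(m) = 0 ↔ m = k`. [folklore] -/
theorem integral_tsum_mul_coe_zpow_haarProbability_circle [MeasurableSpace Circle] [BorelSpace Circle] (c : ℤ → ℂ)
    (hc : Summable fun m => ‖c m‖) (e : ℤ → ℤ) (k : ℤ) (he : ∀ m, e m = 0 ↔ m = k) :
    ∫ z, ∑' m, c m * (z : ℂ) ^ (e m) ∂(haarProbability Circle) = c k := by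
  have hint : ∀ m, Integrable (fun z : Circle => c m * (z : ℂ) ^ (e m)) (haarProbability Circle) :=
    fun m => ((continuous_circle_coe_zpow (e m)).const_mul (c m)).integrable_of_hasCompactSupport
      (HasCompactSupport.of_compactSpace _)
  rw [← integral_tsum_of_summable_integral_norm hint]
  · simp_rw [integral_const_mul, integral_coe_zpow_haarProbability_circle, he]
    rw [tsum_eq_single k]
    · simp
    · intro m hm; simp [hm]
  · refine hc.congr fun m => ?_
    simp [norm_zpow]

/-- A real, even, summable coefficient sequence gives a real Fourier series:
`∑ₙ aₙ Re(zⁿ) = ∑ₙ aₙ zⁿ` (as complex numbers). [folklore] -/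
theorem circle_ofReal_tsum_mul_re_coe_zpow (a : ℤ → ℝ) (ha : Summable a) (heven : ∀ n, a (-n) = a n)
    (z : Circle) :
    ((∑' n : ℤ, a n * ((z ^ n : Circle) : ℂ).re : ℝ) : ℂ) = ∑' n : ℤ, (a n : ℂ) * (z : ℂ) ^ n := by
  have hs : Summable fun n : ℤ => (a n : ℂ) * (z : ℂ) ^ n := by
    refine Summable.of_norm ?_
    simpa [norm_zpow, Circle.norm_coe] using ha.abs
  set S := ∑' n : ℤ, (a n : ℂ) * (z : ℂ) ^ n with hS
  have hzc : (starRingEnd ℂ) (z : ℂ) = (z : ℂ)⁻¹ := by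
    rw [← Circle.coe_inv_eq_conj, Circle.coe_inv]
  have hre : ∑' n : ℤ, (a n : ℂ) * (z : ℂ) ^ (-n) = S := by
    have h := (Equiv.neg ℤ).tsum_eq (fun m => (a m : ℂ) * (z : ℂ) ^ m)
    simp only [Equiv.neg_apply, heven] at h
    exact h
  have hconj : (starRingEnd ℂ) S = S := by
    conv_lhs => rw [hS, Complex.conj_tsum]
    refine (tsum_congr fun n => ?_).trans hre
    rw [map_mul, Complex.conj_ofReal, map_zpow₀, hzc, inv_zpow']
  calc ((∑' n : ℤ, a n * ((z ^ n : Circle) : ℂ).re : ℝ) : ℂ) = ((S.re : ℝ) : ℂ) := by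
        congr 1
        rw [hS, Complex.re_tsum hs]
        exact tsum_congr fun n => by simp
    _ = S := Complex.conj_eq_iff_re.mp hconj

/-! ### The circle heat kernel as a theta function; positivity -/

/-- The circle heat kernel as a complex Fourier series: `p_t(z) = ∑ₙ e^{-n²t/2} zⁿ`
(`t > 0`). [folklore] -/
theorem ofReal_circleHeatKernel {t : ℝ} (ht : 0 < t) (z : Circle) :
    (circleHeatKernel t z : ℂ) =
      ∑' n : ℤ, (Real.exp (-(n : ℝ) ^ 2 * t / 2) : ℂ) * (z : ℂ) ^ n :=
  circle_ofReal_tsum_mul_re_coe_zpow _ (circleHeatKernel_summable_coeff ht) (fun n => by simp) z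

/-- At purely imaginary arguments the theta series has positive terms:
`ϑ(iy, iT) = ∑ₙ e^{-(2π n y + π n² T)}` (as a real series). [folklore] -/
theorem jacobiTheta₂_ofReal_mul_I_eq_ofReal_tsum (y T : ℝ) :
    jacobiTheta₂ (y * I) (T * I) =
      ((∑' n : ℤ, Real.exp (-(2 * Real.pi * n * y + Real.pi * n ^ 2 * T)) : ℝ) : ℂ) := by
  rw [jacobiTheta₂, Complex.ofReal_tsum]
  refine tsum_congr fun n => ?_
  rw [jacobiTheta₂_term, Complex.ofReal_exp]
  congr 1
  push_cast
  linear_combination (2 * ↑Real.pi * (n : ℂ) * (y : ℂ) + ↑Real.pi * (n : ℂ) ^ 2 * (T : ℂ)) *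
    Complex.I_mul_I

/-- **Positivity of the circle heat kernel** (Stein 1970 Ch. II §1 Thm 1 (v) for `U(1)`),
via Jacobi's imaginary transformation `ϑ(z, τ) = (-iτ)^{-1/2} e^{-πiz²/τ} ϑ(z/τ, -1/τ)`
(Mathlib's `jacobiTheta₂_functional_equation`), which turns `p_t(e^{iθ})` into the manifestly
non-negative Villain/Poisson form `√(2π/t) ∑ₘ e^{-(θ - 2πm)²/2t}`. [cite: Stein1970, Ch. II §1 Thm 1] -/
theorem circleHeatKernel_nonneg {t : ℝ} (ht : 0 < t) (z : Circle) : 0 ≤ circleHeatKernel t z := by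
  obtain ⟨θ, rfl⟩ := Circle.exp_surjective z
  set c : ℝ := t / (2 * Real.pi) with hc
  have hc0 : 0 < c := by positivity
  have hτ : I * (t : ℂ) / (2 * Real.pi) = (c : ℂ) * I := by
    rw [hc]; push_cast; ring
  have h1 : -I * ((c : ℂ) * I) = c := by linear_combination (-(c : ℂ)) * Complex.I_mul_I
  have h2 : -↑Real.pi * I * ((θ : ℂ) / (2 * Real.pi)) ^ 2 / ((c : ℂ) * I)
      = ((-(Real.pi * (θ / (2 * Real.pi)) ^ 2 * c⁻¹) : ℝ) : ℂ) := by
    rw [div_eq_mul_inv _ ((c : ℂ) * I), mul_inv, Complex.inv_I]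
    push_cast
    linear_combination (↑Real.pi * ((θ : ℂ) / (2 * ↑Real.pi)) ^ 2 * (c : ℂ)⁻¹) * Complex.I_mul_I
  have h3 : (θ : ℂ) / (2 * Real.pi) / ((c : ℂ) * I) = ((-(θ / (2 * Real.pi) * c⁻¹) : ℝ) : ℂ) * I := by
    rw [div_eq_mul_inv _ ((c : ℂ) * I), mul_inv, Complex.inv_I]
    push_cast
    ring
  have h4 : -1 / ((c : ℂ) * I) = ((c⁻¹ : ℝ) : ℂ) * I := by
    rw [div_eq_mul_inv _ ((c : ℂ) * I), mul_inv, Complex.inv_I]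
    push_cast
    ring
  have h5 : (1 / 2 : ℂ) = ((1 / 2 : ℝ) : ℂ) := by push_cast; ring
  have key : (circleHeatKernel t (Circle.exp θ) : ℂ) =
      ((1 / c ^ (1 / 2 : ℝ) * Real.exp (-(Real.pi * (θ / (2 * Real.pi)) ^ 2 * c⁻¹)) *
        ∑' n : ℤ, Real.exp (-(2 * Real.pi * n * (-(θ / (2 * Real.pi) * c⁻¹)) +
          Real.pi * n ^ 2 * c⁻¹)) : ℝ) : ℂ) := by
    rw [circleHeatKernel_eq_jacobiTheta₂_holds ht θ, jacobiTheta₂_functional_equation, hτ, h1, h2,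
      h3, h4, jacobiTheta₂_ofReal_mul_I_eq_ofReal_tsum, h5, ← Complex.ofReal_cpow hc0.le, ← Complex.ofReal_exp]
    push_cast
    ring
  have key' : circleHeatKernel t (Circle.exp θ) =
      1 / c ^ (1 / 2 : ℝ) * Real.exp (-(Real.pi * (θ / (2 * Real.pi)) ^ 2 * c⁻¹)) *
        ∑' n : ℤ, Real.exp (-(2 * Real.pi * n * (-(θ / (2 * Real.pi) * c⁻¹)) +
          Real.pi * n ^ 2 * c⁻¹)) := by
    exact_mod_cast key
  rw [key']
  exact mul_nonneg (mul_nonneg (by positivity) (Real.exp_pos _).le)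
    (tsum_nonneg fun n => (Real.exp_pos _).le)

/-! ### Continuity -/

/-- Uniform bound `|e^{-n²t/2} Re(zⁿ)| ≤ e^{-n²ε/2}` for `t ≥ ε`. [folklore] -/
theorem norm_circleHeatKernel_term_le {ε t : ℝ} (hεt : ε ≤ t) (n : ℤ) (z : Circle) :
    ‖Real.exp (-(n : ℝ) ^ 2 * t / 2) * ((z ^ n : Circle) : ℂ).re‖ ≤
      Real.exp (-(n : ℝ) ^ 2 * ε / 2) := by
  rw [norm_mul, Real.norm_of_nonneg (Real.exp_pos _).le, Real.norm_eq_abs]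
  have h1 : |((z ^ n : Circle) : ℂ).re| ≤ 1 :=
    (Complex.abs_re_le_norm _).trans (Circle.norm_coe _).le
  have h2 : Real.exp (-(n : ℝ) ^ 2 * t / 2) ≤ Real.exp (-(n : ℝ) ^ 2 * ε / 2) :=
    Real.exp_le_exp.mpr (by nlinarith [sq_nonneg (n : ℝ)])
  calc Real.exp (-(n : ℝ) ^ 2 * t / 2) * |((z ^ n : Circle) : ℂ).re|
      ≤ Real.exp (-(n : ℝ) ^ 2 * t / 2) * 1 :=
        mul_le_mul_of_nonneg_left h1 (Real.exp_pos _).le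
    _ ≤ _ := by rw [mul_one]; exact h2

/-- Joint continuity of `(t, z) ↦ p_t(z)` on `[ε, ∞) × U(1)` for `ε > 0` (the series converges
uniformly there; Stein 1970 Ch. II §1 Thm 1 (viii)). [cite: Stein1970, Ch. II §1 Thm 1] -/
theorem continuousOn_circleHeatKernel_Ici {ε : ℝ} (hε : 0 < ε) :
    ContinuousOn (Function.uncurry circleHeatKernel) (Set.Ici ε ×ˢ Set.univ) := by
  have hcoe : Continuous fun z : Circle => (z : ℂ) := continuous_subtype_val
  have hterm : ∀ n : ℤ, Continuous fun p : ℝ × Circle =>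
      Real.exp (-(n : ℝ) ^ 2 * p.1 / 2) * ((p.2 ^ n : Circle) : ℂ).re := fun n =>
    (Real.continuous_exp.comp ((continuous_const.mul continuous_fst).div_const _)).mul
      (Complex.continuous_re.comp (hcoe.comp ((continuous_zpow n).comp continuous_snd)))
  refine ContinuousOn.congr (f := fun p : ℝ × Circle =>
      ∑' n : ℤ, Real.exp (-(n : ℝ) ^ 2 * p.1 / 2) * ((p.2 ^ n : Circle) : ℂ).re) ?_ (fun p _ => rfl)
  exact continuousOn_tsum (fun n => (hterm n).continuousOn) (circleHeatKernel_summable_coeff hε)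
    fun n p hp => norm_circleHeatKernel_term_le (Set.mem_prod.mp hp).1 n p.2

/-- Joint continuity of `(t, z) ↦ p_t(z)` on `(0, ∞) × U(1)`. [cite: Stein1970, Ch. II §1 Thm 1] -/
theorem continuousOn_uncurry_circleHeatKernel :
    ContinuousOn (Function.uncurry circleHeatKernel) (Set.Ioi (0 : ℝ) ×ˢ Set.univ) := by
  rintro ⟨t, z⟩ ⟨ht, -⟩
  have ht2 : 0 < t / 2 := half_pos ht
  have hmem : Set.Ici (t / 2) ×ˢ (Set.univ : Set Circle) ∈ 𝓝 (t, z) :=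
    prod_mem_nhds (Ici_mem_nhds (half_lt_self ht)) Filter.univ_mem
  exact ((continuousOn_circleHeatKernel_Ici ht2).continuousAt hmem).continuousWithinAt

/-- Continuity of `p_t` on `U(1)` for `t > 0`. [cite: Stein1970, Ch. II §1 Thm 1] -/
theorem continuous_circleHeatKernel {t : ℝ} (ht : 0 < t) : Continuous (circleHeatKernel t) :=
  (continuousOn_circleHeatKernel_Ici ht).comp_continuous
    (f := fun z : Circle => (t, z)) (by fun_prop) fun z => ⟨Set.mem_Ici.mpr le_rfl, Set.mem_univ _⟩

/-- Continuous functions on `U(1)` are integrable for the Haar probability measure. [folklore] -/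
theorem integrable_haarProbability_circle_of_continuous [MeasurableSpace Circle] [BorelSpace Circle]
    {E : Type*} [NormedAddCommGroup E] {F : Circle → E} (hF : Continuous F) :
    Integrable F (haarProbability Circle) :=
  hF.integrable_of_hasCompactSupport (HasCompactSupport.of_compactSpace _)

/-! ### Fourier coefficients and moments of the heat kernel -/

/-- Fourier coefficients of the heat kernel: `∫ z^k p_t(z) dz = e^{-k²t/2}`, i.e.
`T^t e^{ikθ} = e^{-k² t/2} e^{ikθ}` (Stein 1970 Ch. II §1, definition of `T^t` on
eigenfunctions). [cite: Stein1970, Ch. II §1 Thm 1] -/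
theorem integral_coe_zpow_mul_circleHeatKernel [MeasurableSpace Circle] [BorelSpace Circle]
    {t : ℝ} (ht : 0 < t) (k : ℤ) :
    ∫ z, (z : ℂ) ^ k * circleHeatKernel t z ∂(haarProbability Circle) =
      Real.exp (-(k : ℝ) ^ 2 * t / 2) := by
  have h : ∀ z : Circle, (z : ℂ) ^ k * (circleHeatKernel t z : ℂ) =
      ∑' n : ℤ, (Real.exp (-(n : ℝ) ^ 2 * t / 2) : ℂ) * (z : ℂ) ^ (n + k) := by
    intro z
    rw [ofReal_circleHeatKernel ht, ← tsum_mul_left]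
    refine tsum_congr fun n => ?_
    rw [zpow_add₀ (Circle.coe_ne_zero z)]
    ring
  simp_rw [h]
  rw [integral_tsum_mul_coe_zpow_haarProbability_circle _ ?_ (fun n => n + k) (-k) (fun m => by constructor <;> intro h <;> omega)]
  · push_cast
    ring_nf
  · refine (circleHeatKernel_summable_coeff ht).congr fun m => ?_
    rw [Complex.norm_real, Real.norm_of_nonneg (Real.exp_pos _).le]

/-- Normalisation `∫ p_t = 1` (`T^t 1 = 1`, Stein 1970 Ch. II §1 Thm 1 (vi)). [cite: Stein1970, Ch. II §1 Thm 1] -/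
theorem integral_circleHeatKernel [MeasurableSpace Circle] [BorelSpace Circle] {t : ℝ}
    (ht : 0 < t) : ∫ z, circleHeatKernel t z ∂(haarProbability Circle) = 1 := by
  have h := integral_coe_zpow_mul_circleHeatKernel ht 0
  simp only [zpow_zero, one_mul, Int.cast_zero] at h
  rw [integral_complex_ofReal] at h
  have h' : ∫ z, circleHeatKernel t z ∂(haarProbability Circle) = Real.exp (-(0 : ℝ) ^ 2 * t / 2) := by
    exact_mod_cast h
  rw [h']
  simp

/-- Real Fourier coefficients: `∫ Re(z^k) p_t(z) dz = e^{-k²t/2}`. [cite: Stein1970, Ch. II §1 Thm 1] -/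
theorem integral_re_zpow_mul_circleHeatKernel [MeasurableSpace Circle] [BorelSpace Circle]
    {t : ℝ} (ht : 0 < t) (k : ℤ) :
    ∫ z, ((z : ℂ) ^ k).re * circleHeatKernel t z ∂(haarProbability Circle) =
      Real.exp (-(k : ℝ) ^ 2 * t / 2) := by
  have hint : Integrable (fun z : Circle => (z : ℂ) ^ k * circleHeatKernel t z)
      (haarProbability Circle) :=
    integrable_haarProbability_circle_of_continuous
      ((continuous_circle_coe_zpow k).mul (Complex.continuous_ofReal.comp (continuous_circleHeatKernel ht)))
  have h3 := integral_re hint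
  simp only [RCLike.re_to_complex] at h3
  calc ∫ z, ((z : ℂ) ^ k).re * circleHeatKernel t z ∂(haarProbability Circle)
      = ∫ z, ((z : ℂ) ^ k * circleHeatKernel t z).re ∂(haarProbability Circle) := by
        congr 1 with z
        rw [Complex.re_mul_ofReal]
    _ = (∫ z, (z : ℂ) ^ k * circleHeatKernel t z ∂(haarProbability Circle)).re := h3
    _ = _ := by rw [integral_coe_zpow_mul_circleHeatKernel ht k, Complex.ofReal_re]

/-- On the unit circle `(1 - Re z)² = 3/2 - 2 Re z + Re(z²)/2`. [folklore] -/
theorem circle_one_sub_re_sq_eq (z : Circle) :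
    (1 - (z : ℂ).re) ^ 2 = 3 / 2 - 2 * ((z : ℂ) ^ (1 : ℤ)).re + ((z : ℂ) ^ (2 : ℤ)).re / 2 := by
  have h1 : (z : ℂ).re * (z : ℂ).re + (z : ℂ).im * (z : ℂ).im = 1 := by
    rw [← Complex.normSq_apply, Circle.normSq_coe]
  have h2 : ((z : ℂ) ^ (2 : ℤ)).re = (z : ℂ).re * (z : ℂ).re - (z : ℂ).im * (z : ℂ).im := by
    rw [show (2 : ℤ) = ((2 : ℕ) : ℤ) from rfl, zpow_natCast, pow_two, Complex.mul_re]
  rw [zpow_one, h2]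
  linear_combination (1 / 2 : ℝ) * h1

/-- The fourth-moment-type identity
`∫ (1 - Re z)² p_t(z) dz = 3/2 - 2e^{-t/2} + e^{-2t}/2`. [folklore] -/
theorem integral_one_sub_re_sq_mul_circleHeatKernel [MeasurableSpace Circle] [BorelSpace Circle]
    {t : ℝ} (ht : 0 < t) :
    ∫ z, (1 - (z : ℂ).re) ^ 2 * circleHeatKernel t z ∂(haarProbability Circle) =
      3 / 2 - 2 * Real.exp (-t / 2) + Real.exp (-2 * t) / 2 := by
  have hI : ∀ k : ℤ, Integrable (fun z : Circle => ((z : ℂ) ^ k).re * circleHeatKernel t z)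
      (haarProbability Circle) := fun k =>
    integrable_haarProbability_circle_of_continuous
      ((Complex.continuous_re.comp (continuous_circle_coe_zpow k)).mul (continuous_circleHeatKernel ht))
  have hI0 : Integrable (circleHeatKernel t) (haarProbability Circle) :=
    integrable_haarProbability_circle_of_continuous (continuous_circleHeatKernel ht)
  have e1 : ∫ z, ((z : ℂ) ^ (1 : ℤ)).re * circleHeatKernel t z ∂(haarProbability Circle) =
      Real.exp (-t / 2) := by
    rw [integral_re_zpow_mul_circleHeatKernel ht 1]; congr 1; push_cast; ring
  have e2 : ∫ z, ((z : ℂ) ^ (2 : ℤ)).re * circleHeatKernel t z ∂(haarProbability Circle) =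
      Real.exp (-2 * t) := by
    rw [integral_re_zpow_mul_circleHeatKernel ht 2]; congr 1; push_cast; ring
  have hsplit : ∀ z : Circle, (1 - (z : ℂ).re) ^ 2 * circleHeatKernel t z =
      3 / 2 * circleHeatKernel t z - 2 * (((z : ℂ) ^ (1 : ℤ)).re * circleHeatKernel t z) +
        1 / 2 * (((z : ℂ) ^ (2 : ℤ)).re * circleHeatKernel t z) := by
    intro z; rw [circle_one_sub_re_sq_eq]; ring
  simp_rw [hsplit]
  have hA : Integrable (fun z : Circle => 3 / 2 * circleHeatKernel t z -
      2 * (((z : ℂ) ^ (1 : ℤ)).re * circleHeatKernel t z)) (haarProbability Circle) :=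
    (hI0.const_mul _).sub ((hI 1).const_mul _)
  have hB : Integrable (fun z : Circle => 1 / 2 * (((z : ℂ) ^ (2 : ℤ)).re * circleHeatKernel t z))
      (haarProbability Circle) := (hI 2).const_mul _
  have hC : Integrable (fun z : Circle => 3 / 2 * circleHeatKernel t z) (haarProbability Circle) :=
    hI0.const_mul _
  have hD : Integrable (fun z : Circle => 2 * (((z : ℂ) ^ (1 : ℤ)).re * circleHeatKernel t z))
      (haarProbability Circle) := (hI 1).const_mul _
  rw [integral_add hA hB, integral_sub hC hD, integral_const_mul, integral_const_mul,
    integral_const_mul, integral_circleHeatKernel ht, e1, e2]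
  ring

/-- The elementary bound `3/2 - 2e^{-t/2} + e^{-2t}/2 = ½(1-u)²(u²+2u+3) ≤ (3/4) t²`
(`u = e^{-t/2} ≥ 1 - t/2`). [folklore] -/
theorem circleHeatKernel_moment_bound {t : ℝ} (ht : 0 ≤ t) :
    3 / 2 - 2 * Real.exp (-t / 2) + Real.exp (-2 * t) / 2 ≤ 3 / 4 * t ^ 2 := by
  set u := Real.exp (-t / 2) with hu
  have hu4 : Real.exp (-2 * t) = u ^ 4 := by
    rw [hu, ← Real.exp_nat_mul]; congr 1; push_cast; ring
  have hu1 : u ≤ 1 := Real.exp_le_one_iff.mpr (by linarith)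
  have hul : 1 - t / 2 ≤ u := by have := Real.add_one_le_exp (-t / 2); linarith
  have hu0 : 0 < u := Real.exp_pos _
  rw [hu4]
  have hfac : 3 / 2 - 2 * u + u ^ 4 / 2 = (1 - u) ^ 2 * (u ^ 2 + 2 * u + 3) / 2 := by ring
  rw [hfac]
  have h1 : (1 - u) ^ 2 ≤ (t / 2) ^ 2 := pow_le_pow_left₀ (by linarith) (by linarith) 2
  have h2 : u ^ 2 + 2 * u + 3 ≤ 6 := by nlinarith
  have h3 := mul_le_mul h1 h2 (by positivity) (by positivity)
  linarith

/-- On the unit circle `|z - 1|² = 2(1 - Re z)`; hence `ρ ≤ dist z 1` gives `ρ²/2 ≤ 1 - Re z`.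
[folklore] -/
theorem circle_sq_div_two_le_one_sub_re {ρ : ℝ} (hρ : 0 ≤ ρ) {z : Circle} (hz : ρ ≤ dist z 1) :
    ρ ^ 2 / 2 ≤ 1 - (z : ℂ).re := by
  have h1 : (z : ℂ).re * (z : ℂ).re + (z : ℂ).im * (z : ℂ).im = 1 := by
    rw [← Complex.normSq_apply, Circle.normSq_coe]
  have hd : dist z 1 = ‖(z : ℂ) - 1‖ := by
    rw [← Circle.coe_one, ← Complex.dist_eq]; rfl
  have h2 : ‖(z : ℂ) - 1‖ ^ 2 = 2 * (1 - (z : ℂ).re) := by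
    rw [← Complex.normSq_eq_norm_sq, Complex.normSq_apply]
    simp only [Complex.sub_re, Complex.one_re, Complex.sub_im, Complex.one_im, sub_zero]
    linear_combination h1
  have h3 : ρ ^ 2 ≤ ‖(z : ℂ) - 1‖ ^ 2 := pow_le_pow_left₀ hρ (hd ▸ hz) 2
  linarith

/-- `η ≤ 1 - Re z` with `η > 0` gives `1 ≤ η⁻² (1 - Re z)²`. [folklore] -/
theorem one_le_inv_sq_mul_sq_of_le {η x : ℝ} (hη : 0 < η) (hx : η ≤ x) : 1 ≤ η⁻¹ ^ 2 * x ^ 2 := by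
  rw [← mul_pow]
  have h : 1 ≤ η⁻¹ * x := by
    rw [le_inv_mul_iff₀ hη, mul_one]; exact hx
  nlinarith

/-! ### No jumps and approximate identity -/

/-- **No jumps**: `t⁻¹ ∫_{Uᶜ} p_t → 0` as `t → 0⁺` for every neighbourhood `U` of `1`, via the
Chebyshev-type bound `∫_{Uᶜ} p_t ≤ η⁻² ∫ (1 - Re z)² p_t ≤ (3/4) η⁻² t²`. [folklore] -/
theorem circleHeatKernel_noJumps [MeasurableSpace Circle] [BorelSpace Circle] (U : Set Circle)
    (hU : U ∈ 𝓝 (1 : Circle)) :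
    Tendsto (fun t => t⁻¹ * ∫ g in Uᶜ, circleHeatKernel t g ∂(haarProbability Circle))
      (𝓝[>] 0) (𝓝 0) := by
  obtain ⟨ε, hε, hball⟩ := Metric.mem_nhds_iff.mp hU
  set η : ℝ := ε ^ 2 / 2 with hη
  have hη0 : 0 < η := by positivity
  have hcoe : Continuous fun z : Circle => (z : ℂ) := continuous_subtype_val
  have hbound : ∀ t, 0 < t →
      ∫ g in Uᶜ, circleHeatKernel t g ∂(haarProbability Circle) ≤ η⁻¹ ^ 2 * (3 / 4 * t ^ 2) := by
    intro t ht
    have hint : Integrable (circleHeatKernel t) (haarProbability Circle) :=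
      integrable_haarProbability_circle_of_continuous (continuous_circleHeatKernel ht)
    have hint2 : Integrable (fun z : Circle => η⁻¹ ^ 2 * ((1 - (z : ℂ).re) ^ 2 * circleHeatKernel t z))
        (haarProbability Circle) :=
      integrable_haarProbability_circle_of_continuous (continuous_const.mul
        (((continuous_const.sub (Complex.continuous_re.comp hcoe)).pow 2).mul
          (continuous_circleHeatKernel ht)))
    calc ∫ g in Uᶜ, circleHeatKernel t g ∂(haarProbability Circle)
        ≤ ∫ g in (Metric.ball (1 : Circle) ε)ᶜ, circleHeatKernel t g ∂(haarProbability Circle) :=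
          setIntegral_mono_set hint.integrableOn
            (ae_of_all _ fun z => circleHeatKernel_nonneg ht z)
            (Set.compl_subset_compl.mpr hball).eventuallyLE
      _ ≤ ∫ g in (Metric.ball (1 : Circle) ε)ᶜ,
            η⁻¹ ^ 2 * ((1 - (g : ℂ).re) ^ 2 * circleHeatKernel t g) ∂(haarProbability Circle) := by
          refine setIntegral_mono_on hint.integrableOn hint2.integrableOn
            Metric.isOpen_ball.measurableSet.compl fun z hz => ?_
          have hz' : ε ≤ dist z 1 := not_lt.mp fun h => hz (Metric.mem_ball.mpr h)
          have h1 := one_le_inv_sq_mul_sq_of_le hη0 (circle_sq_div_two_le_one_sub_re hε.le hz')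
          have hp := circleHeatKernel_nonneg ht z
          calc circleHeatKernel t z = 1 * circleHeatKernel t z := (one_mul _).symm
            _ ≤ η⁻¹ ^ 2 * (1 - (z : ℂ).re) ^ 2 * circleHeatKernel t z :=
                mul_le_mul_of_nonneg_right h1 hp
            _ = _ := by ring
      _ ≤ ∫ g, η⁻¹ ^ 2 * ((1 - (g : ℂ).re) ^ 2 * circleHeatKernel t g) ∂(haarProbability Circle) :=
          setIntegral_le_integral hint2 (ae_of_all _ fun z =>
            mul_nonneg (by positivity) (mul_nonneg (sq_nonneg _) (circleHeatKernel_nonneg ht z)))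
      _ = η⁻¹ ^ 2 * (3 / 2 - 2 * Real.exp (-t / 2) + Real.exp (-2 * t) / 2) := by
          rw [integral_const_mul, integral_one_sub_re_sq_mul_circleHeatKernel ht]
      _ ≤ η⁻¹ ^ 2 * (3 / 4 * t ^ 2) :=
          mul_le_mul_of_nonneg_left (circleHeatKernel_moment_bound ht.le) (by positivity)
  have hlow : ∀ t : ℝ, 0 < t →
      0 ≤ t⁻¹ * ∫ g in Uᶜ, circleHeatKernel t g ∂(haarProbability Circle) := fun t ht =>
    mul_nonneg (inv_nonneg.mpr ht.le) (integral_nonneg fun z => circleHeatKernel_nonneg ht z)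
  have hup : ∀ t : ℝ, 0 < t →
      t⁻¹ * ∫ g in Uᶜ, circleHeatKernel t g ∂(haarProbability Circle) ≤ 3 / 4 * η⁻¹ ^ 2 * t := by
    intro t ht
    calc t⁻¹ * ∫ g in Uᶜ, circleHeatKernel t g ∂(haarProbability Circle)
        ≤ t⁻¹ * (η⁻¹ ^ 2 * (3 / 4 * t ^ 2)) :=
          mul_le_mul_of_nonneg_left (hbound t ht) (inv_nonneg.mpr ht.le)
      _ = 3 / 4 * η⁻¹ ^ 2 * t := by field_simp
  have hlim : Tendsto (fun t : ℝ => 3 / 4 * η⁻¹ ^ 2 * t) (𝓝[>] 0) (𝓝 0) := by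
    have h := (tendsto_const_nhds (x := 3 / 4 * η⁻¹ ^ 2)).mul (tendsto_id (x := 𝓝 (0 : ℝ)))
    rw [mul_zero] at h
    exact h.mono_left nhdsWithin_le_nhds
  exact tendsto_of_tendsto_of_tendsto_of_le_of_le' tendsto_const_nhds hlim
    (eventually_nhdsWithin_of_forall fun t ht => hlow t ht)
    (eventually_nhdsWithin_of_forall fun t ht => hup t ht)

/-- **Approximate identity**: `∫ f p_t → f(1)` as `t → 0⁺` for continuous `f`
(Stein 1970 Ch. II §1 Thm 1 (iii)/(ix): `T^t f → f` in `C(G)`), via the pointwise bound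
`|f(z) - f(1)| ≤ ε/2 + K (1 - Re z)²` and the moment bound. [cite: Stein1970, Ch. II §1 Thm 1] -/
theorem circleHeatKernel_tendsto_dirac [MeasurableSpace Circle] [BorelSpace Circle]
    (f : C(Circle, ℝ)) :
    Tendsto (fun t => ∫ g, f g * circleHeatKernel t g ∂(haarProbability Circle))
      (𝓝[>] 0) (𝓝 (f 1)) := by
  rw [Metric.tendsto_nhdsWithin_nhds]
  intro ε hε
  obtain ⟨ρ, hρ, hfρ⟩ := Metric.continuous_iff.mp f.continuous 1 (ε / 2) (half_pos hε)
  obtain ⟨C, hC⟩ := isCompact_univ.exists_bound_of_continuousOn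
    (f.continuous.continuousOn (s := Set.univ))
  have hC0 : 0 ≤ C := (norm_nonneg _).trans (hC 1 (Set.mem_univ _))
  set η : ℝ := ρ ^ 2 / 2 with hη
  have hη0 : 0 < η := by positivity
  set K : ℝ := 2 * C * η⁻¹ ^ 2 with hK
  have hK0 : 0 ≤ K := by positivity
  have hcoe : Continuous fun z : Circle => (z : ℂ) := continuous_subtype_val
  -- the pointwise bound
  have hpt : ∀ z : Circle, |f z - f 1| ≤ ε / 2 + K * (1 - (z : ℂ).re) ^ 2 := by
    intro z
    by_cases hz : dist z 1 < ρ
    · have h := hfρ z hz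
      rw [Real.dist_eq] at h
      have : 0 ≤ K * (1 - (z : ℂ).re) ^ 2 := by positivity
      linarith
    · have hz' : ρ ≤ dist z 1 := not_lt.mp hz
      have h1 := one_le_inv_sq_mul_sq_of_le hη0 (circle_sq_div_two_le_one_sub_re hρ.le hz')
      have hfz : |f z| ≤ C := by simpa [Real.norm_eq_abs] using hC z (Set.mem_univ _)
      have hf1 : |f 1| ≤ C := by simpa [Real.norm_eq_abs] using hC 1 (Set.mem_univ _)
      calc |f z - f 1| ≤ |f z| + |f 1| := abs_sub _ _
        _ ≤ 2 * C * 1 := by linarith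
        _ ≤ 2 * C * (η⁻¹ ^ 2 * (1 - (z : ℂ).re) ^ 2) :=
            mul_le_mul_of_nonneg_left h1 (by positivity)
        _ = K * (1 - (z : ℂ).re) ^ 2 := by rw [hK]; ring
        _ ≤ ε / 2 + K * (1 - (z : ℂ).re) ^ 2 := by linarith
  refine ⟨min 1 (ε / (2 * (K + 1))), by positivity, fun {t} ht hdist => ?_⟩
  have ht0 : 0 < t := ht
  rw [Real.dist_eq, sub_zero, abs_of_pos ht0, lt_min_iff] at hdist
  obtain ⟨ht1, htε⟩ := hdist
  have hint : Integrable (circleHeatKernel t) (haarProbability Circle) :=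
    integrable_haarProbability_circle_of_continuous (continuous_circleHeatKernel ht0)
  have hintf : Integrable (fun z => f z * circleHeatKernel t z) (haarProbability Circle) :=
    integrable_haarProbability_circle_of_continuous (f.continuous.mul (continuous_circleHeatKernel ht0))
  have hintabs : Integrable (fun z => |f z - f 1| * circleHeatKernel t z) (haarProbability Circle) :=
    integrable_haarProbability_circle_of_continuous
      ((f.continuous.sub continuous_const).abs.mul (continuous_circleHeatKernel ht0))
  have hint2 : Integrable (fun z : Circle => (1 - (z : ℂ).re) ^ 2 * circleHeatKernel t z)
      (haarProbability Circle) :=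
    integrable_haarProbability_circle_of_continuous
      (((continuous_const.sub (Complex.continuous_re.comp hcoe)).pow 2).mul
        (continuous_circleHeatKernel ht0))
  have hone : ∫ g, f 1 * circleHeatKernel t g ∂(haarProbability Circle) = f 1 := by
    rw [integral_const_mul, integral_circleHeatKernel ht0, mul_one]
  have hsub : ∫ g, f g * circleHeatKernel t g ∂(haarProbability Circle) - f 1 =
      ∫ g, (f g - f 1) * circleHeatKernel t g ∂(haarProbability Circle) := by
    calc ∫ g, f g * circleHeatKernel t g ∂(haarProbability Circle) - f 1
        = ∫ g, f g * circleHeatKernel t g ∂(haarProbability Circle) -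
            ∫ g, f 1 * circleHeatKernel t g ∂(haarProbability Circle) := by rw [hone]
      _ = ∫ g, (f g * circleHeatKernel t g - f 1 * circleHeatKernel t g)
            ∂(haarProbability Circle) := (integral_sub hintf (hint.const_mul _)).symm
      _ = _ := by congr 1 with g; ring
  rw [Real.dist_eq, hsub]
  calc |∫ g, (f g - f 1) * circleHeatKernel t g ∂(haarProbability Circle)|
      ≤ ∫ g, |(f g - f 1) * circleHeatKernel t g| ∂(haarProbability Circle) :=
        abs_integral_le_integral_abs
    _ = ∫ g, |f g - f 1| * circleHeatKernel t g ∂(haarProbability Circle) := by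
        congr 1 with g
        rw [abs_mul, abs_of_nonneg (circleHeatKernel_nonneg ht0 g)]
    _ ≤ ∫ g, (ε / 2 + K * (1 - (g : ℂ).re) ^ 2) * circleHeatKernel t g ∂(haarProbability Circle) := by
        refine integral_mono hintabs ?_ fun g => mul_le_mul_of_nonneg_right (hpt g)
          (circleHeatKernel_nonneg ht0 g)
        exact integrable_haarProbability_circle_of_continuous ((continuous_const.add (continuous_const.mul
          ((continuous_const.sub (Complex.continuous_re.comp hcoe)).pow 2))).mul
            (continuous_circleHeatKernel ht0))
    _ = ε / 2 + K * (3 / 2 - 2 * Real.exp (-t / 2) + Real.exp (-2 * t) / 2) := by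
        have hsplit : ∀ g : Circle, (ε / 2 + K * (1 - (g : ℂ).re) ^ 2) * circleHeatKernel t g =
            ε / 2 * circleHeatKernel t g + K * ((1 - (g : ℂ).re) ^ 2 * circleHeatKernel t g) := by
          intro g; ring
        simp_rw [hsplit]
        rw [integral_add (hint.const_mul _) (hint2.const_mul _), integral_const_mul,
          integral_const_mul, integral_circleHeatKernel ht0,
          integral_one_sub_re_sq_mul_circleHeatKernel ht0, mul_one]
    _ ≤ ε / 2 + K * (3 / 4 * t ^ 2) := by
        have := mul_le_mul_of_nonneg_left (circleHeatKernel_moment_bound ht0.le) hK0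
        linarith
    _ < ε := by
        have h1 : 3 / 4 * t ^ 2 ≤ t := by nlinarith
        have h2 : K * (3 / 4 * t ^ 2) ≤ K * t := mul_le_mul_of_nonneg_left h1 hK0
        have h3 : K * t ≤ K * (ε / (2 * (K + 1))) := mul_le_mul_of_nonneg_left htε.le hK0
        have h4 : K * (ε / (2 * (K + 1))) < ε / 2 := by
          rw [mul_div_assoc', div_lt_div_iff₀ (by positivity) (by positivity)]
          nlinarith
        linarith

/-! ### The semigroup (Chapman–Kolmogorov) property -/

/-- Inner orthogonality step of the convolution identity:
`∫ hⁿ p_t(h⁻¹ g) dh = e^{-n²t/2} gⁿ`. [folklore] -/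
theorem integral_coe_zpow_mul_circleHeatKernel_inv_mul [MeasurableSpace Circle] [BorelSpace Circle]
    {t : ℝ} (ht : 0 < t) (g : Circle) (n : ℤ) :
    ∫ h, (h : ℂ) ^ n * circleHeatKernel t (h⁻¹ * g) ∂(haarProbability Circle) =
      (Real.exp (-(n : ℝ) ^ 2 * t / 2) : ℂ) * (g : ℂ) ^ n := by
  have hexp : ∀ h : Circle, (h : ℂ) ^ n * (circleHeatKernel t (h⁻¹ * g) : ℂ) =
      ∑' m : ℤ, ((Real.exp (-(m : ℝ) ^ 2 * t / 2) : ℂ) * (g : ℂ) ^ m) * (h : ℂ) ^ (n - m) := by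
    intro h
    rw [ofReal_circleHeatKernel ht, ← tsum_mul_left]
    refine tsum_congr fun m => ?_
    rw [Circle.coe_mul, Circle.coe_inv, mul_zpow, inv_zpow, zpow_sub₀ (Circle.coe_ne_zero h),
      div_eq_mul_inv]
    ring
  simp_rw [hexp]
  rw [integral_tsum_mul_coe_zpow_haarProbability_circle _ ?_ (fun m => n - m) n (fun m => by constructor <;> intro h <;> omega)]
  refine (circleHeatKernel_summable_coeff ht).congr fun m => ?_
  rw [norm_mul, norm_zpow, Circle.norm_coe, one_zpow, mul_one, Complex.norm_real,
    Real.norm_of_nonneg (Real.exp_pos _).le]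

/-- **Semigroup property** `p_{s+t}(g) = ∫ p_s(h) p_t(h⁻¹g) dh` (`T^{s} T^{t} = T^{s+t}`,
Stein 1970 Ch. II §1 Thm 1 (ii)): expand `p_s` in characters, integrate term by term and use
`∫ hⁿ p_t(h⁻¹g) dh = e^{-n²t/2} gⁿ`. [cite: Stein1970, Ch. II §1 Thm 1] -/
theorem circleHeatKernel_semigroup [MeasurableSpace Circle] [BorelSpace Circle] {s t : ℝ}
    (hs : 0 < s) (ht : 0 < t) (g : Circle) :
    circleHeatKernel (s + t) g =
      ∫ h, circleHeatKernel s h * circleHeatKernel t (h⁻¹ * g) ∂(haarProbability Circle) := by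
  apply Complex.ofReal_injective
  -- a uniform bound for `p_t`
  obtain ⟨B, hB⟩ := isCompact_univ.exists_bound_of_continuousOn
    ((continuous_circleHeatKernel ht).continuousOn (s := Set.univ))
  have hB0 : 0 ≤ B := (norm_nonneg _).trans (hB 1 (Set.mem_univ _))
  -- the terms `F n h = a_s(n) hⁿ p_t(h⁻¹ g)`
  have hTcont : Continuous fun h : Circle => (circleHeatKernel t (h⁻¹ * g) : ℂ) :=
    Complex.continuous_ofReal.comp
      ((continuous_circleHeatKernel ht).comp (continuous_inv.mul continuous_const))
  have hint : ∀ n : ℤ, Integrable (fun h : Circle => (Real.exp (-(n : ℝ) ^ 2 * s / 2) : ℂ) *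
      ((h : ℂ) ^ n * circleHeatKernel t (h⁻¹ * g))) (haarProbability Circle) := fun n =>
    integrable_haarProbability_circle_of_continuous (continuous_const.mul ((continuous_circle_coe_zpow n).mul hTcont))
  have hsum : Summable fun n : ℤ => ∫ h, ‖(Real.exp (-(n : ℝ) ^ 2 * s / 2) : ℂ) *
      ((h : ℂ) ^ n * circleHeatKernel t (h⁻¹ * g))‖ ∂(haarProbability Circle) := by
    refine Summable.of_nonneg_of_le (fun n => integral_nonneg fun h => norm_nonneg _)
      (fun n => ?_) ((circleHeatKernel_summable_coeff hs).mul_right B)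
    have hle : ∀ h : Circle, ‖(Real.exp (-(n : ℝ) ^ 2 * s / 2) : ℂ) *
        ((h : ℂ) ^ n * circleHeatKernel t (h⁻¹ * g))‖ ≤ Real.exp (-(n : ℝ) ^ 2 * s / 2) * B := by
      intro h
      rw [norm_mul, norm_mul, norm_zpow, Circle.norm_coe, one_zpow, one_mul, Complex.norm_real,
        Real.norm_of_nonneg (Real.exp_pos _).le, Complex.norm_real]
      exact mul_le_mul_of_nonneg_left (hB _ (Set.mem_univ _)) (Real.exp_pos _).le
    calc ∫ h, ‖(Real.exp (-(n : ℝ) ^ 2 * s / 2) : ℂ) * ((h : ℂ) ^ n * circleHeatKernel t (h⁻¹ * g))‖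
          ∂(haarProbability Circle)
        ≤ ∫ _h, Real.exp (-(n : ℝ) ^ 2 * s / 2) * B ∂(haarProbability Circle) :=
          integral_mono (hint n).norm (integrable_const _) hle
      _ = Real.exp (-(n : ℝ) ^ 2 * s / 2) * B := by simp
  calc (circleHeatKernel (s + t) g : ℂ)
      = ∑' n : ℤ, (Real.exp (-(n : ℝ) ^ 2 * (s + t) / 2) : ℂ) * (g : ℂ) ^ n :=
        ofReal_circleHeatKernel (add_pos hs ht) g
    _ = ∑' n : ℤ, (Real.exp (-(n : ℝ) ^ 2 * s / 2) : ℂ) *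
          ((Real.exp (-(n : ℝ) ^ 2 * t / 2) : ℂ) * (g : ℂ) ^ n) := by
        refine tsum_congr fun n => ?_
        rw [← mul_assoc, ← Complex.ofReal_mul, ← Real.exp_add]
        congr 3
        ring
    _ = ∑' n : ℤ, (Real.exp (-(n : ℝ) ^ 2 * s / 2) : ℂ) *
          ∫ h, (h : ℂ) ^ n * circleHeatKernel t (h⁻¹ * g) ∂(haarProbability Circle) := by
        simp_rw [integral_coe_zpow_mul_circleHeatKernel_inv_mul ht g]
    _ = ∑' n : ℤ, ∫ h, (Real.exp (-(n : ℝ) ^ 2 * s / 2) : ℂ) *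
          ((h : ℂ) ^ n * circleHeatKernel t (h⁻¹ * g)) ∂(haarProbability Circle) := by
        simp_rw [integral_const_mul]
    _ = ∫ h, ∑' n : ℤ, (Real.exp (-(n : ℝ) ^ 2 * s / 2) : ℂ) *
          ((h : ℂ) ^ n * circleHeatKernel t (h⁻¹ * g)) ∂(haarProbability Circle) :=
        integral_tsum_of_summable_integral_norm hint hsum
    _ = ∫ h, (circleHeatKernel s h : ℂ) * circleHeatKernel t (h⁻¹ * g) ∂(haarProbability Circle) := by
        congr 1 with h
        rw [ofReal_circleHeatKernel hs h, ← tsum_mul_right]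
        exact tsum_congr fun n => by ring
    _ = ((∫ h, circleHeatKernel s h * circleHeatKernel t (h⁻¹ * g) ∂(haarProbability Circle) : ℝ) : ℂ) := by
        rw [← integral_complex_ofReal]
        push_cast
        rfl

/-- Inversion invariance `p_t(g⁻¹) = p_t(g)` (`Re (ḡⁿ) = Re (gⁿ)`). [folklore] -/
theorem circleHeatKernel_inv (t : ℝ) (g : Circle) : circleHeatKernel t g⁻¹ = circleHeatKernel t g := by
  simp only [circleHeatKernel, inv_zpow, Circle.coe_inv_eq_conj, Complex.conj_re]

/-! ### The discharge -/

/-- **The circle heat kernel is a heat kernel** in the sense of `IsGroupHeatKernel`: discharge of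
the named fact `isGroupHeatKernel_circleHeatKernel` (Stein 1970 Ch. II §1, Theorem 1, for
`G = U(1)` with `Δ = d²/dθ²` and the probabilists' time `t/2`; positivity via Jacobi's imaginary
transformation, the approximate-identity and no-jump properties via the fourth-moment bound
`∫ (1 - Re z)² p_t ≤ (3/4) t²`). [cite: Stein1970, Ch. II §1 Thm 1] -/
theorem isGroupHeatKernel_circleHeatKernel_holds : isGroupHeatKernel_circleHeatKernel := by
  intro _ _
  exact
    { continuousOn := continuousOn_uncurry_circleHeatKernel
      nonneg := fun t ht g => circleHeatKernel_nonneg ht g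
      integral_eq_one := fun t ht => integral_circleHeatKernel ht
      semigroup := fun s t hs ht g => circleHeatKernel_semigroup hs ht g
      central := fun t _ g h => by rw [mul_comm h g, mul_inv_cancel_right]
      symm := fun t _ g => circleHeatKernel_inv t g
      tendsto_dirac := circleHeatKernel_tendsto_dirac
      noJumps := circleHeatKernel_noJumps }

end Literature.MathematicalPhysics.QuantumLattice
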